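import Summits.QuantumFields.BalabanUV.T4Continuum.Support.NE3EnergyChartLeaves
import Summits.QuantumFields.BalabanUV.T4Continuum.Support.NE3EnergyHessContTwoTerm

/-!
# T⁴ programme, node NE3, route P2 «ENERGY CONVEXITY» — sub-row S5-Y0-chart, file 2∕2: THE CONVEXITY MECHANISM IN THE
# η-WEIGHTED NORM.  The continuity constant of the periodised Wilson Hessian in the weighted norm
# `√(curlSq W · F + dirSq · F ∕ s²)` is DISCHARGED by this lineage's two-term route, for ALL directions (read through the
# periodic extension), with the DISPLAYED constant `Λ_w = (1 + 24√d·(e^α − 1)·s)² + 48·d·a·s²`; hence the END of the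
# surviving variant (R3) of F-ne3p1-g19-1 at one pair: `N_w(Γ 0) ≤ (1 + θ₀)·(2r∕c)` from chart leaves in the weighted
# norm, a weighted tangent coercivity `c` (ML_w) and a weighted residual constant `r` (RES♯-shape) — `k`-free as soon as
# `α·s` and `a·s²` are bounded (`s = L^k`)

NE3 (node U1b) formalisation swarm, leaf seat `b2b-balaban-t4-ne3-formalise-leaf-03` (gen 5), sub-row **S5-Y0-chart** of
`HOME/t4/formal/NE3/LEAVES.md`, second file (first file: `Support/NE3EnergyChartLeaves` — the hypothesis structure
`ChartLeaves … Nrm …` with the norm a parameter and the norm-generic END `norm_le_of_chartLeaves`).  CONTEXT: the row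
owner's located error `HOME/t4/b2b-balaban-t4-ne3-p1/g19/F-ne3p1-g19-1.md` — in the UNIT-SCALE norm the tangent
coercivity L5 is false k-uniformly; the surviving variant (R3) is the same convexity mechanism in the η-WEIGHTED norm
`N_w(Z)² = curlSq W Z F + L^{−2k}·dirSq Z F` with (ML_w) a k-free weighted coercivity and (RES♯) a curl-paired residual,
neither in the tree.  WHAT THIS FILE PROVES ([folklore]; 0 `def`, 0 sorry):
* §1 `isPeriodicDir_sub` (bookkeeping) and **`ChartLeaves.of_eqOn_periodic`** — chart leaves transfer between two norm
  functionals that AGREE ON PERIODIC directions (every direction the fields measure — `Ψ t − Ψ 1`, `Ψ 1`, `Γ 0`, `Y ∈ T` — is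
  periodic, §2 of file 1);
* §2 **`cont_weighted`** — for a unitary background `W`, a path of skew fields `Γ t` with `‖Γ t (b)‖ ≤ α`, plaquette radius `a`
  of `W_t := W·exp Γ(t)` on the period window, `1 ≤ P`, `0 < s`: for every `t ∈ [0,1]` and ALL direction fields `Y, Z`,
  `|HsPer W_t (perWin d P) P Y Z| ≤ Λ_w · N(perExt P Y) · N(perExt P Z)`, `N(Y) := √(curlSq W Y (periodBox P) + dirSq Y (periodBox P)∕s²)`,
  `Λ_w := (1 + 24√d·(e^α − 1)·s)² + 48·d·a·s²` — `NE3EnergyHessContTwoTerm.abs_hessSym_perWin_vary_le_weighted` BY NAME at the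
  periodic extensions (`NE3EnergyHessCont.perExt`, `HsPer_apply`); the weighted twin of `NE3EnergyHessCont.abs_HsPer_le_energyNorm`;
* §3 **`normW_le_of_chartLeaves`** — THE WEIGHTED END AT ONE PAIR: chart leaves in the weighted norm (coercivity `c`, chart
  bounds `θ, θ₀`, acceleration `κ`, plaquette radius `a`), the sup-radius `α` of the path, `U_A` a minimiser, `W` unitary,
  the residual shape `|d∕dσ A(W e^{σΨ₁})| ≤ r·N_w(Ψ 1)` and the budget `2Λ_wθ + Λ_wθ² + κ ≤ c∕2` ⟹
  **`√(curlSq W (Γ 0) F + dirSq (Γ 0) F∕s²) ≤ (1 + θ₀)·(2r∕c)`** (file 1's `norm_le_of_chartLeaves` with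
  `Nrm := N ∘ perExt P`, §1, §2); **`normW_le_of_chartLeaves_level`** — the same with `s := L^k` written out: the one-pair
  form of (T-E_w) ⇐ (ML_w: `coer`) ∧ (RES♯-shape: `hres`) ∧ chart leaves, with `Λ_w` k-FREE under the two displayed
  smallness data `α·L^k`, `a·L^{2k}` of the chart path;
* §4 non-vacuity of file 1's `ChartLeaves` for every norm functional vanishing at `0` (flat data), instantiated at the
  unit-scale `energyNorm`.

HONEST FRAMING.  Finite-T⁴ bookkeeping (rung (B)+1); kernel composition of landed lemmas; (ML_w) and (RES♯) are NOT
proved here — they enter as the field `coer` and the hypothesis `hres` (typed over tree objects, asserted for nothing);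
no `k`-uniformity is claimed beyond the displayed dependence of `Λ_w` on `(α·s, a·s²)`; T-E ∕ T-E_w NOT proved; NE3 NOT
proved; spine PROVED 0∕9; no conditional of the cell used or hidden; NOT infinite volume, NOT a mass gap, NOT Clay, NOT
summit progress.  ABSOLUTE RULE kept: no printed sentence is a hypothesis (context only: [Balaban1985Variational] Prop. 3
p. 289, (81)–(84) p. 290; [Balaban1985BackgroundPropagators] (3.46) p. 398 for the physical weight).  PLACEMENT:
`Summits/QuantumFields/BalabanUV/`; imports file 1 and this lineage's `Support.NE3EnergyHessContTwoTerm` (gen 4) BY NAME.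
HONEST DEPENDENCY: continuum YM on T⁴ ⇐ BetaPertH ∧ nine spine estimates (0/9 proved); BetaPertH ⇐ (D1) ∧ (D4) ∧ CAP+tail;
G-an2-4 gates asym, D1 and NE2/3/4.
-/

set_option autoImplicit false

open scoped BigOperators Matrix.Norms.L2Operator
open NormedSpace Finset

namespace Summit.QuantumFields.BalabanUV.T4Continuum.NE3EnergyChartLeavesWeighted

open Set
open Literature.MathematicalPhysics.QuantumFieldTheory.Balaban1983to89
open B7Prop1Explicit B7Prop2Explicit MatrixLog UnitaryModel
open T4AveragingDeficitWall hiding Site Plane Plaq Bond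
open T4AveragingDeficitWallBoundary (IsPeriodicCfg periodBox)
open AveragingDeficitPeriodicCounting (IsPeriodicDir)
open AveragingDeficitChartCalculus (cavg)
open AveragingDeficitPlaqDeriv (vary_isUnitaryCfg)
open MinimalActionLevels (perWin)
open MinimalActionSandwich (IsMinimiser admissible)
open NE3EnergyShapes (energyNorm energyNorm_nonneg)
open NE3HessForm (dAction hess)
open NE3EnergyHessBilin (hessSym)
open NE3EnergyHessCont (HsPer HsPer_apply perExt isPeriodicDir_perExt perExt_eq_of_periodic)
open NE3EnergyHessContTwoTerm (abs_hessSym_perWin_vary_le_weighted)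
open NE3EnergyChartLeaves (ChartLeaves isPeriodicDir_vel norm_le_of_chartLeaves)

noncomputable section

variable {d : ℕ} {n : Type*} [Fintype n] [DecidableEq n]

/-! ## §1 Chart leaves transfer between norms agreeing on periodic directions -/

omit [Fintype n] [DecidableEq n] in
/-- The difference of two `P`-periodic direction fields is `P`-periodic. [folklore] -/
theorem isPeriodicDir_sub {Y Z : Site d → Fin d → Matrix n n ℂ} {P : ℤ} (hY : IsPeriodicDir Y P)
    (hZ : IsPeriodicDir Z P) : IsPeriodicDir (Y - Z) P := by
  intro x κ μ
  simp only [Pi.sub_apply, hY x κ μ, hZ x κ μ]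

/-- **TRANSFER OF CHART LEAVES BETWEEN NORMS AGREEING ON PERIODIC DIRECTIONS.**  Every direction the fields of
`ChartLeaves` measure — `Ψ t − Ψ 1` and `Ψ 1` (`velocity`, `accel`; periodic by file 1's `isPeriodicDir_vel`), `Γ 0`
(`close`), `Y ∈ T` (`coer`, field `perT`) — is `(N·L^k)`-periodic; so if `Nrm'` agrees with `Nrm` on periodic fields, chart
leaves in `Nrm` are chart leaves in `Nrm'`.  Used with `Nrm' := Nrm ∘ perExt P` (§3). [folklore] -/
theorem ChartLeaves.of_eqOn_periodic {𝒞 : ℕ → Set (Site d → Fin d → (Matrix n n ℂ)ˣ)} {L N k : ℕ}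
    {V UA UB : Site d → Fin d → (Matrix n n ℂ)ˣ} {u : Site d → (Matrix n n ℂ)ˣ}
    {Γ Ψ Ψ' : ℝ → Site d → Fin d → Matrix n n ℂ} {T : Set (Site d → Fin d → Matrix n n ℂ)}
    {Nrm Nrm' : (Site d → Fin d → Matrix n n ℂ) → ℝ} {c θ κ θ₀ a : ℝ}
    (hN : ∀ Y, IsPeriodicDir Y ((N * L ^ k : ℕ) : ℤ) → Nrm' Y = Nrm Y)
    (h : ChartLeaves 𝒞 L N k V UA UB u Γ Ψ Ψ' T Nrm c θ κ θ₀ a) :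
    ChartLeaves 𝒞 L N k V UA UB u Γ Ψ Ψ' T Nrm' c θ κ θ₀ a := by
  have hΨP : ∀ t ∈ Icc (0:ℝ) 1, IsPeriodicDir (Ψ t) ((N * L ^ k : ℕ) : ℤ) :=
    fun t ht => isPeriodicDir_vel h.per (h.vel t ht)
  have h1 : IsPeriodicDir (Ψ 1) ((N * L ^ k : ℕ) : ℤ) := hΨP 1 ⟨zero_le_one, le_rfl⟩
  exact
    { gauge := h.gauge
      rep := h.rep
      endW := h.endW
      skew := h.skew
      per := h.per
      vel := h.vel
      acc := h.acc
      skewEnd := h.skewEnd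
      skewAcc := h.skewAcc
      adm := h.adm
      tangent := h.tangent
      perT := h.perT
      velocity := fun t ht => by
        rw [hN _ (isPeriodicDir_sub (hΨP t ht) h1), hN _ h1]
        exact h.velocity t ht
      close := by
        rw [hN _ (h.per 0), hN _ h1]
        exact h.close
      coer := fun t ht Y hY => by
        rw [hN _ (h.perT Y hY)]
        exact h.coer t ht Y hY
      small := h.small
      accel := fun t ht => by
        rw [hN _ h1]
        exact h.accel t ht }

/-! ## §2 The continuity constant of the periodised Hessian in the weighted norm, all directions -/

/-- **`cont` IN THE WEIGHTED NORM, ALL DIRECTIONS, DISPLAYED CONSTANT.**  For a unitary background `W`, a path of skew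
direction fields `Γ t` with `‖Γ t (b)‖ ≤ α` (`α ≥ 0`), the moving configuration `W_t := vary W (Γ t) 1` with plaquette
radius `a ≥ 0` on the period window `perWin d P` for `t ∈ [0,1]`, `1 ≤ P` and a weight `s > 0`: for every `t ∈ [0,1]` and
ALL direction fields `Y, Z`,
`|HsPer W_t (perWin d P) P Y Z| ≤ [(1 + 24√d·(e^α − 1)·s)² + 48·d·a·s²] · N(perExt P Y) · N(perExt P Z)`,
`N(Y) := √(curlSq W Y (periodBox P) + dirSq Y (periodBox P)∕s²)` — this lineage's two-term weighted display
`NE3EnergyHessContTwoTerm.abs_hessSym_perWin_vary_le_weighted` BY NAME at the periodic extensions (`HsPer V W P Y Z =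
hessSym V W (perExt P Y) (perExt P Z)`).  With `s = L^k` the constant is k-FREE once `α·L^k` and `a·L^{2k}` are bounded.
[folklore] -/
theorem cont_weighted [Nonempty n] {W : Site d → Fin d → (Matrix n n ℂ)ˣ} (hW : IsUnitaryCfg W)
    {Γ : ℝ → Site d → Fin d → Matrix n n ℂ} (hΓ : ∀ t, IsSkewDir (Γ t)) {α : ℝ} (hα : 0 ≤ α)
    (hΓα : ∀ t (x : Site d) (μ : Fin d), ‖Γ t x μ‖ ≤ α) {P : ℕ} (hP : 1 ≤ P) {a : ℝ} (ha0 : 0 ≤ a)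
    (ha : ∀ t ∈ Icc (0:ℝ) 1, ∀ p ∈ perWin d P,
      ‖((fhol (vary W (Γ t) 1) p : (Matrix n n ℂ)ˣ) : Matrix n n ℂ) - 1‖ ≤ a)
    {s : ℝ} (hs : 0 < s) :
    ∀ t ∈ Icc (0:ℝ) 1, ∀ Y Z : Site d → Fin d → Matrix n n ℂ,
      |HsPer (vary W (Γ t) 1) (perWin d P) P Y Z|
        ≤ ((1 + 24 * Real.sqrt d * (Real.exp α - 1) * s) ^ 2 + 48 * d * a * s ^ 2)
          * Real.sqrt (curlSq W (perExt P Y) (periodBox P) + dirSq (perExt P Y) (periodBox P) / s ^ 2)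
          * Real.sqrt (curlSq W (perExt P Z) (periodBox P) + dirSq (perExt P Z) (periodBox P) / s ^ 2) := by
  intro t ht Y Z
  rw [HsPer_apply]
  have h := abs_hessSym_perWin_vary_le_weighted hW (hΓ t) hα (hΓα t) 1 hP ha0 (ha t ht)
    (isPeriodicDir_perExt P Y) (isPeriodicDir_perExt P Z) hs
  simpa only [abs_one, one_mul] using h

/-! ## §3 The weighted END at one pair -/

/-- **THE WEIGHTED END AT ONE PAIR** (the one-pair form of the surviving variant (R3) of F-ne3p1-g19-1).  For any class
family `𝒞`, level `k`, `1 ≤ L`, `1 ≤ N·L^k`, a unitary background `W = cavg L U_B`, a weight `s > 0`, chart leaves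
`h` in the WEIGHTED norm `N_s(Y) := √(curlSq W Y (periodBox (N·L^k)) + dirSq Y (periodBox (N·L^k))∕s²)` (coercivity `c` =
(ML_w)'s constant, chart bounds `θ, θ₀`, acceleration `κ`, plaquette radius `a ≥ 0`), the sup-radius `α ≥ 0` of the path,
`U_A` a minimiser of run `k`, the residual shape `|d∕dσ|₀ A(W e^{σΨ₁})| ≤ r·N_s(Ψ 1)` ((RES♯)-shape, `r ≥ 0`), `0 < c`,
`0 ≤ θ₀` and the budget `2Λ_wθ + Λ_wθ² + κ ≤ c∕2` with `Λ_w := (1 + 24√d·(e^α − 1)·s)² + 48·d·a·s²`: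
  **`N_s(Γ 0) ≤ (1 + θ₀)·(2r∕c)`.**
File 1's `norm_le_of_chartLeaves` with `Nrm := N_s ∘ perExt`, §1 (`N_s ∘ perExt = N_s` on periodic directions) and §2.
[folklore] -/
theorem normW_le_of_chartLeaves [Nonempty n] {𝒞 : ℕ → Set (Site d → Fin d → (Matrix n n ℂ)ˣ)} {L N k : ℕ}
    (hL : 1 ≤ L) (hP : 1 ≤ N * L ^ k) {V UA UB : Site d → Fin d → (Matrix n n ℂ)ˣ}
    (hW : IsUnitaryCfg (cavg L UB)) {u : Site d → (Matrix n n ℂ)ˣ} {Γ Ψ Ψ' : ℝ → Site d → Fin d → Matrix n n ℂ}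
    {T : Set (Site d → Fin d → Matrix n n ℂ)} {c θ κ θ₀ a r α s : ℝ} (hs : 0 < s) (hα : 0 ≤ α) (ha0 : 0 ≤ a)
    (h : ChartLeaves 𝒞 L N k V UA UB u Γ Ψ Ψ' T
      (fun Y => Real.sqrt (curlSq (cavg L UB) Y (periodBox (N * L ^ k)) + dirSq Y (periodBox (N * L ^ k)) / s ^ 2))
      c θ κ θ₀ a)
    (hΓα : ∀ t (x : Site d) (μ : Fin d), ‖Γ t x μ‖ ≤ α) (hA : IsMinimiser d 𝒞 L N k V UA)
    (hθ₀ : 0 ≤ θ₀) (hr : 0 ≤ r) (hc : 0 < c)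
    (hbudget : 2 * ((1 + 24 * Real.sqrt d * (Real.exp α - 1) * s) ^ 2 + 48 * d * a * s ^ 2) * θ
      + ((1 + 24 * Real.sqrt d * (Real.exp α - 1) * s) ^ 2 + 48 * d * a * s ^ 2) * θ ^ 2 + κ ≤ c / 2)
    (hres : ∀ D : ℝ, HasDerivAt (fun σ : ℝ => fineAction (vary (cavg L UB) (Ψ 1) σ) (perWin d (N * L ^ k))) D 0 →
      |D| ≤ r * Real.sqrt (curlSq (cavg L UB) (Ψ 1) (periodBox (N * L ^ k))
        + dirSq (Ψ 1) (periodBox (N * L ^ k)) / s ^ 2)) :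
    Real.sqrt (curlSq (cavg L UB) (Γ 0) (periodBox (N * L ^ k)) + dirSq (Γ 0) (periodBox (N * L ^ k)) / s ^ 2)
      ≤ (1 + θ₀) * (2 * r / c) := by
  -- the weighted norm read through the periodic extension agrees with the weighted norm on periodic directions
  have hN : ∀ Y : Site d → Fin d → Matrix n n ℂ, IsPeriodicDir Y ((N * L ^ k : ℕ) : ℤ) →
      Real.sqrt (curlSq (cavg L UB) (perExt (N * L ^ k) Y) (periodBox (N * L ^ k))
        + dirSq (perExt (N * L ^ k) Y) (periodBox (N * L ^ k)) / s ^ 2)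
      = Real.sqrt (curlSq (cavg L UB) Y (periodBox (N * L ^ k)) + dirSq Y (periodBox (N * L ^ k)) / s ^ 2) := by
    intro Y hY
    rw [perExt_eq_of_periodic _ hY]
  have h' := ChartLeaves.of_eqOn_periodic
    (Nrm' := fun Y => Real.sqrt (curlSq (cavg L UB) (perExt (N * L ^ k) Y) (periodBox (N * L ^ k))
      + dirSq (perExt (N * L ^ k) Y) (periodBox (N * L ^ k)) / s ^ 2)) hN h
  have h1 : IsPeriodicDir (Ψ 1) ((N * L ^ k : ℕ) : ℤ) := isPeriodicDir_vel h.per (h.vel 1 ⟨zero_le_one, le_rfl⟩)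
  have hΛ : (0 : ℝ) ≤ (1 + 24 * Real.sqrt d * (Real.exp α - 1) * s) ^ 2 + 48 * d * a * s ^ 2 := by positivity
  have hres' : ∀ D : ℝ, HasDerivAt (fun σ : ℝ => fineAction (vary (cavg L UB) (Ψ 1) σ) (perWin d (N * L ^ k))) D 0 →
      |D| ≤ r * Real.sqrt (curlSq (cavg L UB) (perExt (N * L ^ k) (Ψ 1)) (periodBox (N * L ^ k))
        + dirSq (perExt (N * L ^ k) (Ψ 1)) (periodBox (N * L ^ k)) / s ^ 2) := by
    intro D hD
    rw [hN _ h1]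
    exact hres D hD
  have hend := norm_le_of_chartLeaves hL hW (fun Y => Real.sqrt_nonneg _) h' hA hΛ hθ₀ hr hc hbudget
    (cont_weighted hW h.skew hα hΓα hP ha0 h.small hs) hres'
  rw [hN _ (h.per 0)] at hend
  exact hend

/-- **THE WEIGHTED END AT LEVEL `k`, `s := L^k`** — Bałaban's physical weight (`η = L^{−k}`:
`N_w(Z)² = curlSq W Z F + L^{−2k}·dirSq Z F`, written `dirSq∕(L^k)²`): under the hypotheses of `normW_le_of_chartLeaves`
with `s = L^k`, `N_w(Γ 0) ≤ (1 + θ₀)·(2r∕c)` where the continuity constant is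
`Λ_w = (1 + 24√d·(e^α − 1)·L^k)² + 48·d·a·L^{2k}` — k-FREE as soon as the chart path's sup-radius obeys `α·L^k ≤ const`
and the moving configurations' plaquette radius obeys `a·L^{2k} ≤ const` (Bałaban's regime: directions `O(η)`, plaquette
variables `O(η²)`).  This is the one-pair form of (T-E_w) ⇐ (ML_w) ∧ (RES♯) ∧ chart leaves. [folklore] -/
theorem normW_le_of_chartLeaves_level [Nonempty n] {𝒞 : ℕ → Set (Site d → Fin d → (Matrix n n ℂ)ˣ)} {L N k : ℕ}
    (hL : 1 ≤ L) (hN1 : 1 ≤ N) {V UA UB : Site d → Fin d → (Matrix n n ℂ)ˣ}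
    (hW : IsUnitaryCfg (cavg L UB)) {u : Site d → (Matrix n n ℂ)ˣ} {Γ Ψ Ψ' : ℝ → Site d → Fin d → Matrix n n ℂ}
    {T : Set (Site d → Fin d → Matrix n n ℂ)} {c θ κ θ₀ a r α : ℝ} (hα : 0 ≤ α) (ha0 : 0 ≤ a)
    (h : ChartLeaves 𝒞 L N k V UA UB u Γ Ψ Ψ' T
      (fun Y => Real.sqrt (curlSq (cavg L UB) Y (periodBox (N * L ^ k))
        + dirSq Y (periodBox (N * L ^ k)) / ((L : ℝ) ^ k) ^ 2)) c θ κ θ₀ a)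
    (hΓα : ∀ t (x : Site d) (μ : Fin d), ‖Γ t x μ‖ ≤ α) (hA : IsMinimiser d 𝒞 L N k V UA)
    (hθ₀ : 0 ≤ θ₀) (hr : 0 ≤ r) (hc : 0 < c)
    (hbudget : 2 * ((1 + 24 * Real.sqrt d * (Real.exp α - 1) * (L : ℝ) ^ k) ^ 2 + 48 * d * a * ((L : ℝ) ^ k) ^ 2) * θ
      + ((1 + 24 * Real.sqrt d * (Real.exp α - 1) * (L : ℝ) ^ k) ^ 2 + 48 * d * a * ((L : ℝ) ^ k) ^ 2) * θ ^ 2 + κ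
        ≤ c / 2)
    (hres : ∀ D : ℝ, HasDerivAt (fun σ : ℝ => fineAction (vary (cavg L UB) (Ψ 1) σ) (perWin d (N * L ^ k))) D 0 →
      |D| ≤ r * Real.sqrt (curlSq (cavg L UB) (Ψ 1) (periodBox (N * L ^ k))
        + dirSq (Ψ 1) (periodBox (N * L ^ k)) / ((L : ℝ) ^ k) ^ 2)) :
    Real.sqrt (curlSq (cavg L UB) (Γ 0) (periodBox (N * L ^ k)) + dirSq (Γ 0) (periodBox (N * L ^ k)) / ((L : ℝ) ^ k) ^ 2)
      ≤ (1 + θ₀) * (2 * r / c) := by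
  have hL0 : (0 : ℝ) < L := by exact_mod_cast hL
  have hs : (0 : ℝ) < (L : ℝ) ^ k := pow_pos hL0 k
  have hP : 1 ≤ N * L ^ k := Nat.mul_pos (by omega) (Nat.pow_pos (by omega))
  exact normW_le_of_chartLeaves hL hP hW hs hα ha0 h hΓα hA hθ₀ hr hc hbudget hres

/-! ## §4 Non-vacuity of `ChartLeaves` (flat data, any norm vanishing at `0`) -/

/-- **NON-VACUITY OF `ChartLeaves`**: in the flat class with the flat datum and the flat pair, the trivial data — gauge
`u = 1`, constant path `Γ ≡ 0` with velocities `Ψ ≡ 0`, `Ψ′ ≡ 0`, tangent space `T = {0}` — satisfy every field of file 1's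
`ChartLeaves` for every norm functional with `Nrm 0 = 0` and all constants with `0 ≤ a` (every inequality reads `0 ≤ 0`,
`c·0 ≤ hess(0,0) = 0` or `‖1 − 1‖ ≤ a`).  So the hypothesis structure is consistent. [folklore] -/
theorem chartLeaves_flat (L N k : ℕ) {Nrm : (Site d → Fin d → Matrix n n ℂ) → ℝ}
    (hN0 : Nrm (0 : Site d → Fin d → Matrix n n ℂ) = 0) (c θ κ θ₀ : ℝ) {a : ℝ} (ha : 0 ≤ a) :
    ChartLeaves (MinimalActionWitness.flatClass (d := d) (n := n)) L N k MinimalActionWitness.flatCfg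
      MinimalActionWitness.flatCfg MinimalActionWitness.flatCfg (fun _ => 1)
      (fun _ _ _ => 0) (fun _ _ _ => 0) (fun _ _ _ => 0) {fun _ _ => 0} Nrm c θ κ θ₀ a := by
  have hW : cavg L (MinimalActionWitness.flatCfg (d := d) (n := n)) = MinimalActionWitness.flatCfg :=
    NE3EnergyShapes.rescale_bavg_flatCfg L
  have hN0' : Nrm (fun (_ : Site d) (_ : Fin d) => (0 : Matrix n n ℂ)) = 0 := hN0
  have hvary : vary (cavg L (MinimalActionWitness.flatCfg (d := d) (n := n)))
      (fun (_ : Site d) (_ : Fin d) => (0 : Matrix n n ℂ)) 1 = MinimalActionWitness.flatCfg := by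
    rw [hW]; exact vary_zero_dir _ _
  refine
    { gauge := ⟨fun _ => (unitaryUnits (Matrix n n ℂ)).one_mem, fun _ _ => rfl⟩
      rep := ?_
      endW := rfl
      skew := fun _ _ _ => (skewAdjoint _).zero_mem
      per := fun _ _ _ _ => rfl
      vel := fun t _ y μ => (hasDerivAt_const t (exp (0 : Matrix n n ℂ))).congr_deriv (by simp)
      acc := fun t _ y μ => hasDerivAt_const t _
      skewEnd := fun _ _ => (skewAdjoint _).zero_mem
      skewAcc := fun _ _ _ _ => (skewAdjoint _).zero_mem
      adm := fun t _ => ?_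
      tangent := Set.mem_singleton _
      perT := fun Y hY => ?_
      velocity := fun t _ => ?_
      close := ?_
      coer := fun t _ Y hY => ?_
      small := fun t _ p _ => ?_
      accel := fun t _ => ?_ }
  · -- `rep`: `flat^1 = flat = flat·exp 0`
    show gaugeAct (fun _ => (1 : (Matrix n n ℂ)ˣ)) MinimalActionWitness.flatCfg
      = vary (cavg L MinimalActionWitness.flatCfg) (fun (_ : Site d) (_ : Fin d) => (0 : Matrix n n ℂ)) 1
    rw [hvary, NE3EnergyShapes.gaugeAct_one]
  · -- `adm`
    show vary (cavg L MinimalActionWitness.flatCfg) (fun (_ : Site d) (_ : Fin d) => (0 : Matrix n n ℂ)) 1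
      ∈ admissible MinimalActionWitness.flatClass L k MinimalActionWitness.flatCfg
    rw [hvary]; exact MinimalActionWitness.flatCfg_mem_admissible L k
  · -- `perT`
    rw [Set.mem_singleton_iff] at hY
    rw [hY]; exact fun _ _ _ => rfl
  · -- `velocity`: `0 ≤ θ·0`
    simp [sub_self, hN0, hN0']
  · -- `close`: `0 ≤ (1+θ₀)·0`
    simp [hN0']
  · -- `coer`: `c·0² ≤ hess(0,0) = 0`
    rw [Set.mem_singleton_iff] at hY
    subst hY
    simp [hN0', NE3HessForm.hess_zero_left]
  · -- `small`: `‖1 − 1‖ ≤ a`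
    simp [hvary, MinimalActionWitness.fhol_flatCfg, ha]
  · -- `accel`: `a·0 ≤ κ·0²`
    simp [hN0']

/-- The flat chart leaves in the unit-scale energy norm (file 1 §4's currency). [folklore] -/
theorem chartLeaves_flat_energyNorm (L N k : ℕ) (c θ κ θ₀ : ℝ) {a : ℝ} (ha : 0 ≤ a) :
    ChartLeaves (MinimalActionWitness.flatClass (d := d) (n := n)) L N k MinimalActionWitness.flatCfg
      MinimalActionWitness.flatCfg MinimalActionWitness.flatCfg (fun _ => 1)
      (fun _ _ _ => 0) (fun _ _ _ => 0) (fun _ _ _ => 0) {fun _ _ => 0}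
      (fun Y => energyNorm (cavg L (MinimalActionWitness.flatCfg (d := d) (n := n))) Y (periodBox (N * L ^ k)))
      c θ κ θ₀ a :=
  chartLeaves_flat L N k (NE3EnergyShapes.energyNorm_zero _ _) c θ κ θ₀ ha

end

end Summit.QuantumFields.BalabanUV.T4Continuum.NE3EnergyChartLeavesWeighted
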